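import Summits.QuantumAdvantage.QuantumAdvantage.Theorems.CubicForrelationNearExactIsExactTwelvePartnerR2Blocks
import Summits.QuantumAdvantage.QuantumAdvantage.Theorems.CubicForrelationNearExactIsExactTwelvePartnerLeaves

/-!
# Crux `CubicForrelation.NearExactIsExact` (stmt-QuantumAdvantage-14043) — n = 12, E1280-even, R2 leaf T(b) ASSEMBLED: frame data +
  light structure + pairing partner ⇒ contradiction (E1280-HANDPROOFS.md §1.1)

Certificate seat `b2b-cforr-cert` (gen 39).  HONEST FRAMING: kernel-checked (standard axioms) END-TO-END version of one leaf of the E1280-even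
analysis in the coefficient-tensor language: given the partner equations in the rank-2 frame (`hpair`, `hF1`), descendant `t̄ = T = s₀s₁s₂`
(`htb`: no monomial of `t̄` meets `F = {s₃..s₈}`), and the LIGHT STRUCTURE of sub-case (b) in parametrised form — `G_{F,·} = g νᵀ` (type (0,1):
`G_{FF} = 0`, `rank G_{UF} ≤ 1`) and `Γ_{F,·} = m μᵀ + m′ μ′ᵀ` (types (0,0), (0,1), (1,0): the columns of `Γ_{F,·}` lie in a 2-space) — there is
no partner.  Template for the other leaves: (E3) of …TwelvePartnerR2Blocks on `F × F`, then `tpl_R2_Tb_core`.  What is NOT here: the frame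
itself, the cell lemmas producing the light structure, the bridge from …TwelveDigitPairing.  NOT summit progress.
-/

set_option linter.dupNamespace false -- D-0017: single-problem summit ⇒ `QuantumAdvantage.QuantumAdvantage` by design

namespace Summit.QuantumAdvantage.QuantumAdvantage.Theorems.CubicForrelation.NearExactIsExact

open Finset Matrix

/-- **R2 leaf T(b), assembled.**  See the module docstring.  Indices: `Fin.castAdd 9 a` = `y_{a+1}`, `Fin.natAdd 3 s` = `σ_s`, and inside
`Fin 9 = Fin (3 + 6)`: `Fin.castAdd 6 u` = `U = {s₀,s₁,s₂}`, `Fin.natAdd 3 f` = `F = {s₃..s₈}`. [this work] -/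
theorem tpa_R2_Tb (c d : Fin (3 + 9) → Fin (3 + 9) → Fin (3 + 9) → ZMod 2)
    (hcs : ∀ p j k, c p k j = c p j k) (hcc : ∀ p j k, c j p k = c p j k)
    (hds : ∀ φ j k, d φ k j = d φ j k) (hdc : ∀ φ j k, d j φ k = d φ j k) (hdd : ∀ φ j, d φ j j = 0)
    (hpair : ∀ p φ, (∑ j, ∑ k, (if j < k then c p j k * d φ j k else 0)) = if p = φ then 1 else 0)
    (hF1 : ∀ j k, d (Fin.castAdd 9 0) j k =
      if (j = Fin.castAdd 9 1 ∧ k = Fin.castAdd 9 2) ∨ (j = Fin.castAdd 9 2 ∧ k = Fin.castAdd 9 1) then 1 else 0)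
    (htb : ∀ (f : Fin 6) (s t : Fin (3 + 6)),
      d (Fin.natAdd 3 (Fin.natAdd 3 f)) (Fin.natAdd 3 s) (Fin.natAdd 3 t) = 0)
    (g m m' : Fin 6 → ZMod 2) (ν μ μ' : Fin (3 + 6) → ZMod 2)
    (hG : ∀ (f : Fin 6) (s : Fin (3 + 6)), d (Fin.castAdd 9 1) (Fin.natAdd 3 (Fin.natAdd 3 f)) (Fin.natAdd 3 s) = g f * ν s)
    (hΓ : ∀ (f : Fin 6) (s : Fin (3 + 6)),
      d (Fin.castAdd 9 2) (Fin.natAdd 3 (Fin.natAdd 3 f)) (Fin.natAdd 3 s) = m f * μ s + m' f * μ' s) : False := by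
  -- (E3) on F × F: the `τ` term vanishes by `htb`
  have hE3 := tpb_E3 c d hcs hcc hds hdc hdd hpair hF1
  set α : Fin 6 → ZMod 2 := fun x => ∑ s, ν s * c (Fin.castAdd 9 1) (Fin.natAdd 3 s) (Fin.natAdd 3 (Fin.natAdd 3 x)) with hα
  set β : Fin 6 → ZMod 2 := fun x => ∑ s, μ s * c (Fin.castAdd 9 2) (Fin.natAdd 3 s) (Fin.natAdd 3 (Fin.natAdd 3 x)) with hβ
  set β' : Fin 6 → ZMod 2 := fun x => ∑ s, μ' s * c (Fin.castAdd 9 2) (Fin.natAdd 3 s) (Fin.natAdd 3 (Fin.natAdd 3 x)) with hβ'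
  have hiffF : ∀ r x : Fin 6, ((Fin.natAdd 3 r : Fin (3 + 6)) = Fin.natAdd 3 x) ↔ r = x := fun r x => by
    constructor
    · intro h'; have := congrArg Fin.val h'; simp only [Fin.val_natAdd] at this; exact Fin.ext (by omega)
    · rintro rfl; rfl
  have hblock' : ∀ r x : Fin 6, g r * α x + m r * β x + m' r * β' x = if r = x then 1 else 0 := by
    intro r x
    have h := hE3 (Fin.natAdd 3 r) (Fin.natAdd 3 x)
    have hτ : (∑ s, ∑ t, (if s < t then c (Fin.natAdd 3 (Fin.natAdd 3 x)) (Fin.natAdd 3 s) (Fin.natAdd 3 t) *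
        d (Fin.natAdd 3 (Fin.natAdd 3 r)) (Fin.natAdd 3 s) (Fin.natAdd 3 t) else 0)) = 0 :=
      Finset.sum_eq_zero fun s _ => Finset.sum_eq_zero fun t _ => by rw [htb, mul_zero, ite_self]
    rw [hτ, add_zero] at h
    rw [show (if (Fin.natAdd 3 r : Fin (3 + 6)) = Fin.natAdd 3 x then (1 : ZMod 2) else 0) = if r = x then 1 else 0 from by
      by_cases hrx : r = x
      · rw [if_pos ((hiffF r x).2 hrx), if_pos hrx]
      · rw [if_neg (fun h' => hrx ((hiffF r x).1 h')), if_neg hrx]] at h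
    rw [← h, hα, hβ, hβ']
    simp only [Finset.mul_sum, ← Finset.sum_add_distrib]
    refine Finset.sum_congr rfl fun s _ => ?_
    rw [hG, hΓ]
    ring
  have hblock : ∀ r x : Fin 6, (∑ i, (![g, m, m', 0, 0, 0] : Fin 6 → Fin 6 → ZMod 2) i r * (![α, β, β', 0, 0, 0] : Fin 6 → Fin 6 → ZMod 2) i x)
      = if r = x then 1 else 0 := by
    intro r x
    rw [Fin.sum_univ_six, ← hblock' r x]
    simp
  exact tpl_R2_Tb_core _ _ hblock rfl

end Summit.QuantumAdvantage.QuantumAdvantage.Theorems.CubicForrelation.NearExactIsExact
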